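import Summits.QuantumFields.YangMills.Theorems.BalabanLadderIRcofSchurFejerWindow
import HarnessLib

/-!
# Schur–Fejér splitting window — §4: the splitting weight `w = E_β · W_N` (clauses 1–6 of `TwistSplitWeight`; clause 7 isolated)

Ideator `ym-ir-idea-22` g4 · crux `IRcof` (stmt-QuantumFields-26930) · line `Cruxes/IRcof/Lines/equipartition_seam.lean` rev 4, stub S2ᵛ; source
`Cruxes/IRcof/Lines/equipartition_seam_SchurFejerCore.lean` rev 4 (9f3231cc9009) §4, extracted VERBATIM by the custody LEAD ym-ir-line-ab-p1 g7 (LEAD LANE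
PROTOCOL (b)) as a SEPARATE file because §1–§3 (`Theorems/BalabanLadderIRcofSchurFejerWindow.lean`, p670440) already sits at the 400-line cap; same namespace
`…Cruxes.IRcof.EquipartitionSeam.SchurFejer` (K3′: never `open` it wholesale downstream — short names `blind`, `splitW`).

CONTENT: `blind π r β = exp (β Re tr r∘π)` (`continuous_blind`, `blind_pos`, `blind_kernel_mul` — `ker π`-blindness, `blind_inv`, `blind_conj`),
`splitW π r ρH N β = blind · window`; `isPosDefKernel_blind` (`reTrace_posType` + `IsPosDefKernel.exp`, `β ≥ 0`), `isPosDefKernel_window`, `splitW_posType`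
(clause 5, Schur product of the two kernels), `splitW_exact` (clause 6: `∑ᶠ k ∈ ker π, w(k h) = exp (β Re tr r(π h))`), and ★ `twistSplitWeight_cyclic_of_noise`
— at a cyclic-scalar cover datum and `β ≥ 0`, `TwistSplitWeight π ρH r c β w` holds as soon as its clause 7 (label noise) holds.
NOT here: the Laplace step (clause 7), the general finite central `Γ`.  HONEST: algebra for one stub of one registered line (row 47, mechanism 0); width 0;
YM mass gap (Clay) NOT proved; `IRcof` 0∕1; R4 = `BalabanLadder.UV` only.  Gate-forced only: one-line docstrings where the lint requires them.
-/

set_option autoImplicit false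

noncomputable section

open Finset Complex

namespace Summit.QuantumFields.YangMills.Cruxes.IRcof.EquipartitionSeam.SchurFejer

/-! ### §4 The splitting weight `w = E_β · W_N`: clauses 1–6 of `TwistSplitWeight`, clause 7 isolated

`E_β(h) = exp (β Re tr r(π h))` is the centre-BLIND Wilson density (`ker π`-invariant, continuous, symmetric, central, of
positive type for `β ≥ 0` by `reTrace_posType` + `IsPosDefKernel.exp`).  For `w := E_β · W_N`: clauses 1–5 of
`TwistSplitWeight` hold (product of positive-type kernels: `IsPosDefKernel.mul`, i.e. Schur once more, then the tree's
real→complex passage `re_sum_conj_mul_nonneg_of_real`), clause 6 is `E_β(h) · Σ_{k ∈ ker π} W_N(k h) = E_β(h)` by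
`window_exact`; so `TwistSplitWeight π ρH r c β w` is EQUIVALENT to its clause 7 (the label-noise inequality) — the
Laplace step is all that remains of S2ᵛ at a cyclic-scalar cover datum (`twistSplitWeight_cyclic_of_noise`). -/

section Split

open MeasureTheory
open Literature.MathematicalPhysics.QuantumFieldTheory Literature.MathematicalPhysics.QuantumLattice
open Literature.RepresentationTheory.CompactGroups (re_sum_conj_mul_nonneg_of_real sum_mul_mul_nonneg_of_complex)
open Literature.Analysis.Matrix (IsPosDefKernel)
open Summit.QuantumFields.YangMills.Theorems.NonSimplyConnectedLatticeGap

variable {G H : Type} [Group G] [TopologicalSpace G] [Group H] [TopologicalSpace H]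

/-- The centre-blind Wilson density `E_β(h) = exp (β Re tr r(π h))`. -/
def blind (π : H →* G) (r : LatticeRep G) (β : ℝ) (h : H) : ℝ := Real.exp (β * (r.ρ (π h)).trace.re)

/-- The Schur–Fejér splitting weight `w = E_β · W_N`. -/
def splitW (π : H →* G) (r : LatticeRep G) (ρH : LatticeRep H) (N : ℕ) (β : ℝ) (h : H) : ℝ :=
  blind π r β h * window ρH N h

/-- `E_β` is continuous (for continuous `π`). -/
lemma continuous_blind (π : H →* G) (r : LatticeRep G) (β : ℝ) (hπ : Continuous π) :
    Continuous (blind π r β) :=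
  Real.continuous_exp.comp (continuous_const.mul ((continuous_reTrace r).comp hπ))

omit [TopologicalSpace H] in
/-- `E_β > 0`. -/
lemma blind_pos (π : H →* G) (r : LatticeRep G) (β : ℝ) (h : H) : 0 < blind π r β h := Real.exp_pos _

omit [TopologicalSpace H] in
/-- `E_β` is `ker π`-blind. -/
lemma blind_kernel_mul (π : H →* G) (r : LatticeRep G) (β : ℝ) {k : H} (hk : k ∈ π.ker) (h : H) :
    blind π r β (k * h) = blind π r β h := by
  unfold blind
  rw [map_mul, MonoidHom.mem_ker.1 hk, one_mul]

omit [TopologicalSpace H] in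
/-- `E_β(h⁻¹) = E_β(h)`. -/
lemma blind_inv (π : H →* G) (r : LatticeRep G) (β : ℝ) (h : H) : blind π r β h⁻¹ = blind π r β h := by
  unfold blind
  rw [map_inv, reTrace_inv]

omit [TopologicalSpace H] in
/-- `E_β` is a class function. -/
lemma blind_conj (π : H →* G) (r : LatticeRep G) (β : ℝ) (g h : H) :
    blind π r β (g * h * g⁻¹) = blind π r β h := by
  have hπ' : π (g * h * g⁻¹) = π g * π h * (π g)⁻¹ := by simp only [map_mul, map_inv]
  unfold blind
  rw [hπ', reTrace_conj]

omit [TopologicalSpace H] in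
/-- `E_β` is of (real) positive type for `β ≥ 0` (`Re tr r` is, `reTrace_posType`; then BCR 3.1.14 `IsPosDefKernel.exp`). -/
theorem isPosDefKernel_blind (π : H →* G) (r : LatticeRep G) {β : ℝ} (hβ : 0 ≤ β) :
    IsPosDefKernel fun x y : H => blind π r β (x⁻¹ * y) := by
  have hK : IsPosDefKernel fun x y : H => (r.ρ (π (x⁻¹ * y))).trace.re := by
    refine ⟨fun x y => ?_, fun n x c => ?_⟩
    · dsimp only
      rw [show y⁻¹ * x = (x⁻¹ * y)⁻¹ by rw [mul_inv_rev, inv_inv], map_inv, reTrace_inv]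
    · have := reTrace_posType r n (fun i => π (x i)) c
      simpa only [map_mul, map_inv] using this
  exact (hK.const_mul hβ).exp

/-- The window is of (real) positive type (from `window_posType`). -/
theorem isPosDefKernel_window (ρH : LatticeRep H) (N : ℕ) :
    IsPosDefKernel fun x y : H => window ρH N (x⁻¹ * y) := by
  refine ⟨fun x y => ?_, fun n x c => ?_⟩
  · dsimp only
    rw [show y⁻¹ * x = (x⁻¹ * y)⁻¹ by rw [mul_inv_rev, inv_inv], window_inv]
  · exact sum_mul_mul_nonneg_of_complex (f := window ρH N) (window_posType ρH N) n x c

/-- Clause 5 for `w = E_β · W_N` (Schur product of the two kernels, then real → complex test vectors). -/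
theorem splitW_posType (π : H →* G) (r : LatticeRep G) (ρH : LatticeRep H) (N : ℕ) {β : ℝ} (hβ : 0 ≤ β)
    (n : ℕ) (x : Fin n → H) (v : Fin n → ℂ) :
    0 ≤ (∑ i, ∑ j, (starRingEnd ℂ) (v i) * v j * ((splitW π r ρH N β ((x i)⁻¹ * x j) : ℝ) : ℂ)).re :=
  re_sum_conj_mul_nonneg_of_real (f := splitW π r ρH N β)
    (fun n x c => ((isPosDefKernel_blind π r hβ).mul (isPosDefKernel_window ρH N)).2 n x c) n x v

/-- Clause 6 for `w = E_β · W_N` at a cyclic-scalar cover datum: `Σ_{k ∈ ker π} w(k h) = E_β(h)` EXACTLY. -/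
theorem splitW_exact (π : H →* G) (r : LatticeRep G) (ρH : LatticeRep H) {k₀ : H}
    (hker : π.ker = Subgroup.zpowers k₀) {N : ℕ} (hN : orderOf k₀ = N) (hNpos : 0 < N) {ω : ℂ}
    (hω : IsPrimitiveRoot ω N) (hk₀ : ρH.ρ k₀ = ω • (1 : Matrix (Fin ρH.N) (Fin ρH.N) ℂ)) (β : ℝ) (h : H) :
    ∑ᶠ k ∈ (π.ker : Set H), splitW π r ρH N β (k * h) = Real.exp (β * (r.ρ (π h)).trace.re) := by
  have h1 : ∀ k ∈ (π.ker : Set H), splitW π r ρH N β (k * h) = blind π r β h * window ρH N (k * h) := by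
    intro k hk
    unfold splitW
    rw [blind_kernel_mul π r β (SetLike.mem_coe.1 hk)]
  rw [finsum_mem_congr rfl h1, ← mul_finsum_mem, window_exact ρH π.ker hker hN hNpos hω hk₀ h, mul_one]
  rfl

/-- **S2ᵛ at a cyclic-scalar cover datum REDUCES TO ITS NOISE CLAUSE.**  For `π : H → G` with
`ker π = ⟨k₀⟩` of order `N`, `ρH k₀ = ω • 1` (`ω` a primitive `N`-th root), `β ≥ 0` and any `c`, the weight
`w = E_β · W_N` satisfies `TwistSplitWeight π ρH r c β w` as soon as it satisfies clause 7 (the label-noise bound on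
the `ρH`-cell of `1`); clauses 1–6 are the theorems above. -/
theorem twistSplitWeight_cyclic_of_noise [IsTopologicalGroup H] [CompactSpace H] [MeasurableSpace H]
    [BorelSpace H] (π : H →* G) (hπ : Continuous π) (ρH : LatticeRep H) (hd : 0 < ρH.N) {k₀ : H}
    (hker : π.ker = Subgroup.zpowers k₀) {N : ℕ} (hN : orderOf k₀ = N) (hNpos : 0 < N) {ω : ℂ}
    (hω : IsPrimitiveRoot ω N) (hk₀ : ρH.ρ k₀ = ω • (1 : Matrix (Fin ρH.N) (Fin ρH.N) ℂ))
    (r : LatticeRep G) {β : ℝ} (hβ : 0 ≤ β) (c : ℝ)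
    (hnoise : ∫ h in {h : H | (∀ k' : H, k' ∈ π.ker → k' ≠ 1 →
        (ρH.ρ (k'⁻¹ * h)).trace.re < (ρH.ρ h).trace.re)},
        (Real.exp (β * (r.ρ (π h)).trace.re) - splitW π r ρH N β h) ∂(haarProbability H) ≤
      Real.exp (-(c * β)) * ∫ h, splitW π r ρH N β h ∂(haarProbability H)) :
    TwistSplitWeight π ρH r c β (splitW π r ρH N β) := by
  have _ := hd
  unfold TwistSplitWeight
  refine ⟨(continuous_blind π r β hπ).mul (continuous_window ρH N),
    fun h => mul_nonneg (blind_pos π r β h).le (window_nonneg ρH N h), fun h => ?_, fun g h => ?_,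
    splitW_posType π r ρH N hβ, splitW_exact π r ρH hker hN hNpos hω hk₀ β, hnoise⟩
  · unfold splitW
    rw [blind_inv, window_inv]
  · unfold splitW
    rw [blind_conj, window_conj]

end Split

end Summit.QuantumFields.YangMills.Cruxes.IRcof.EquipartitionSeam.SchurFejer

end
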